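import Summits.RiemannHypothesis.RiemannHypothesis.Theses.ScrewDustWall
import Summits.RiemannHypothesis.RiemannHypothesis.Theorems.Splittings.ScrewDustNonSeparation
import HarnessLib

/-!
# Route `ScrewDustWall` (X-11 «DUST WALL»), item `DustDoesNotSeparate` (stmt-RiemannHypothesis-21692) — closed

Token-for-token the route decl: for every closed `T ⊆ ℂ` whose trace on the open unit disc is totally
disconnected, `𝔻 ∖ T` is preconnected.  This is
`ScrewDust.isPreconnected_ball_diff_of_isTotallyDisconnected`
(`Theorems/Splittings/ScrewDustNonSeparation.lean`: Eilenberg–Borsuk — the ratio `(z - a)/(z - b)`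
has a continuous logarithm on `sphere 0 1 ∪ (T ∩ 𝔻)` by a clopen splitting of the totally
disconnected part, contradicting `Literature.Topology.PlaneTopology.not_hasLogOn_div_sub` if `a`, `b`
lay in different open pieces of `𝔻 ∖ T`).  Support item (plane topology) of the RH-equivalence X-11;
RH is not proved by this and nothing here bears on the truth of RH.
-/

set_option linter.dupNamespace false

namespace Summit.RiemannHypothesis.RiemannHypothesis.Theorems.Splittings.ScrewDust

/-- **Item `DustDoesNotSeparate` (stmt-RiemannHypothesis-21692)** of route `ScrewDustWall`: a closed
set whose trace on the open unit disc is totally disconnected does not separate the disc.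
[cite: Eilenberg1936, Thm. 4] -/
theorem DustDoesNotSeparate_proof :
    Summit.RiemannHypothesis.RiemannHypothesis.Theses.ScrewDustWall.DustDoesNotSeparate :=
  fun _ hT hTd => isPreconnected_ball_diff_of_isTotallyDisconnected hT hTd

end Summit.RiemannHypothesis.RiemannHypothesis.Theorems.Splittings.ScrewDust
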